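import Literature.NumberTheory.Rogawski1990.ArchSingularStableOrbitalEqOfRegular   -- ★ p842366 (D5) (this seat): the two-carrier signed end state from equal regular ORBIT-MEASURE states
import Literature.NumberTheory.Automorphic.ArchStableOrbitalRegularState        -- ★ p841429 (R1-0): `Φ^st_∞(t z, Θ∘coe) = K⁻¹ Σ_ρ ∫ Θ d(⊗ regular orbit measures)` at regular `z`
import HarnessLib

/-!
# EQUAL REGULAR STABLE ORBITAL INTEGRALS ⇒ EQUAL SIGNED SINGULAR STABLE ORBITAL INTEGRALS on two diagonal carriers ((R1) «(L-use) at all indefinite places», the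
# «method of §8.2» END TO END in stable-orbital-integral currency; Rogawski 1990 §8.2 pp. 122–124, §14.5 pp. 238–239, §4.1 (4.1.1)–(4.1.2))

Topic `NumberTheory/Rogawski1990`; namespace `Literature.NumberTheory.Rogawski1990`.  THEOREMS ONLY (no `def`, no instance, no notation, no axiom, no named fact, no `sorry`).
Cell `pub/hodgecm-mathlib`, ENGINE T1 (crux H413 = `stmt-HodgeConjecture-24833`); floor-2 road «(J-nc) in-house», brick (R1-i-a) (LEAD F0P3a-plan (g9) WORD T8-119∕T8-120); author
F0P3a-p07 (g8), 2026-09-01.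

WHAT.  ★ p842366 `prod_mul_archStableOrbitalIntegral_kottwitzSign_eq_of_regular_eq_of_clause` consumes the regular identity in ORBIT-MEASURE currency (`hreg`).  Print's input is
(14.2.1): the REGULAR stable orbital integrals of a transfer pair agree at corresponding regular points.  ★ p841429 (R1-0)
`archStableOrbitalIntegral_archDiagTorus_eq_inv_mul_sum_integral_pi_map_conj` reads `Φ^st_{mreg}(t z, Θ∘coe)` — for a family `mreg` CANONICAL on the regular classes for the product
Haar measure `e⁻¹_*(⊗ ν_v)` — as `K⁻¹ Σ_ρ ∫ Θ d(⊗_v reg_v(z_v∘ρ_v))`.  Hence **`prod_mul_archStableOrbitalIntegral_kottwitzSign_eq_of_archStableOrbitalIntegral_regular_eq`**: the same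
conclusion `(∏_v (−2M_v))·Φ^st_∞,α(t_α z⁰, e_∞·(Θ∘coe); m) = (∏_v (−2M′_v))·Φ^st_∞,β(t_β z⁰, e_∞·(Θ′∘coe); m′)` from
`hregΦ : ∀ z regular, Φ^st_{mreg}(t_α z, Θ∘coe) = Φ^st_{mreg′}(t_β z, Θ′∘coe)` (any canonical regular families `mreg`, `mreg′`; the singular families `m`, `m′` in Weil form at the wall
classes are SEPARATE data, as in (ST-∞)).
NOT HERE: (m1) the transport `U(H′)`∕`U(Φ₃)` → diagonal carriers, (m2) the wall torus point of `γ₀ ⊗ 1`, `hregΦ` from `IsArchInnerTransfer` + correspondence of regular torus points,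
the discharge of the clause∕link∕value∕Weil-form hypotheses.
HONEST LABEL: HC_CM is proved only modulo the 7 printed citations until rung 0 closes; this file is assembly of ★ bricks and pays nothing by itself.

## References
* [Rogawski1990] J. D. Rogawski, *Automorphic Representations of Unitary Groups in Three Variables*, Ann. of Math. Stud. 123 (1990), §8.2 pp. 122–124, §14.5 pp. 238–239, §4.1.
* [Varadarajan1989] V. S. Varadarajan, *An Introduction to Harmonic Analysis on Semisimple Lie Groups* (1989), §6.4 Thm 22.
* [BorelJacquet1979] A. Borel, H. Jacquet, *Automorphic forms and automorphic representations*, PSPM 33.1 (1979), §4.1.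
-/

set_option autoImplicit false

noncomputable section

open MeasureTheory Measure Filter Topology NumberField NumberField.InfinitePlace NumberField.mixedEmbedding Equiv Function Set
open Literature.MeasureTheory.Group Literature.NumberTheory.Automorphic Literature.NumberTheory.Automorphic.UnitaryGroup
open Literature.LinearAlgebra.Matrix
open scoped Matrix MatrixGroups Matrix.Norms.Operator ContDiff NNReal ENNReal

namespace Literature.NumberTheory.Rogawski1990

variable (L : Type) [Field L] [NumberField L] [IsCMField L] (α β : Fin 3 → L)
  [iGL : MeasurableSpace (GL (Fin 3) ℂ)] [iGLb : BorelSpace (GL (Fin 3) ℂ)]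
  [iAα : MeasurableSpace (arch (↥(maximalRealSubfield L)) L (IsCMField.complexConj L) 3 (Matrix.diagonal α))] [iAαb : BorelSpace (arch (↥(maximalRealSubfield L)) L (IsCMField.complexConj L) 3 (Matrix.diagonal α))]
  [iAβ : MeasurableSpace (arch (↥(maximalRealSubfield L)) L (IsCMField.complexConj L) 3 (Matrix.diagonal β))] [iAβb : BorelSpace (arch (↥(maximalRealSubfield L)) L (IsCMField.complexConj L) 3 (Matrix.diagonal β))]
  [iQα : ∀ γ' : arch (↥(maximalRealSubfield L)) L (IsCMField.complexConj L) 3 (Matrix.diagonal α),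
    MeasurableSpace (arch (↥(maximalRealSubfield L)) L (IsCMField.complexConj L) 3 (Matrix.diagonal α) ⧸ Subgroup.centralizer ({γ'} : Set _))]
  [iQαb : ∀ γ' : arch (↥(maximalRealSubfield L)) L (IsCMField.complexConj L) 3 (Matrix.diagonal α),
    BorelSpace (arch (↥(maximalRealSubfield L)) L (IsCMField.complexConj L) 3 (Matrix.diagonal α) ⧸ Subgroup.centralizer ({γ'} : Set _))]
  [iQβ : ∀ γ' : arch (↥(maximalRealSubfield L)) L (IsCMField.complexConj L) 3 (Matrix.diagonal β),
    MeasurableSpace (arch (↥(maximalRealSubfield L)) L (IsCMField.complexConj L) 3 (Matrix.diagonal β) ⧸ Subgroup.centralizer ({γ'} : Set _))]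
  [iQβb : ∀ γ' : arch (↥(maximalRealSubfield L)) L (IsCMField.complexConj L) 3 (Matrix.diagonal β),
    BorelSpace (arch (↥(maximalRealSubfield L)) L (IsCMField.complexConj L) 3 (Matrix.diagonal β) ⧸ Subgroup.centralizer ({γ'} : Set _))]
  [iLα : ∀ (v : {w : InfinitePlace L // IsComplex w}) (g : archLocal L 3 (Matrix.diagonal α) v),
    MeasurableSpace (archLocal L 3 (Matrix.diagonal α) v ⧸ Subgroup.centralizer ({g} : Set (archLocal L 3 (Matrix.diagonal α) v)))]
  [iLαb : ∀ (v : {w : InfinitePlace L // IsComplex w}) (g : archLocal L 3 (Matrix.diagonal α) v),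
    BorelSpace (archLocal L 3 (Matrix.diagonal α) v ⧸ Subgroup.centralizer ({g} : Set (archLocal L 3 (Matrix.diagonal α) v)))]
  [iLβ : ∀ (v : {w : InfinitePlace L // IsComplex w}) (g : archLocal L 3 (Matrix.diagonal β) v),
    MeasurableSpace (archLocal L 3 (Matrix.diagonal β) v ⧸ Subgroup.centralizer ({g} : Set (archLocal L 3 (Matrix.diagonal β) v)))]
  [iLβb : ∀ (v : {w : InfinitePlace L // IsComplex w}) (g : archLocal L 3 (Matrix.diagonal β) v),
    BorelSpace (archLocal L 3 (Matrix.diagonal β) v ⧸ Subgroup.centralizer ({g} : Set (archLocal L 3 (Matrix.diagonal β) v)))]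

open scoped Classical in
/-- **(R1) EQUAL REGULAR STABLE ORBITAL INTEGRALS ⇒ EQUAL SIGNED SINGULAR STABLE ORBITAL INTEGRALS, up to the explicit constants `∏_v (−2M_v)`, `∏_v (−2M′_v)`** — ★ p842366
with its regular hypothesis `hreg` in STABLE-ORBITAL-INTEGRAL currency: `Φ^st_{mreg}(t_α z, Θ∘coe) = Φ^st_{mreg′}(t_β z, Θ′∘coe)` at every REGULAR `z`, for families `mreg`, `mreg′`
canonical on the regular classes for the product Haar measures (★ p841429 (R1-0) converts).  See the module docstring.
[cite: Rogawski1990, §8.2 p. 124; §14.5 pp. 238–239; §4.1 (4.1.2) p. 39] [cite: Varadarajan1989, §6.4 Thm 22] [cite: DeitmarEchterhoff2014, Thm. 1.5.3] -/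
theorem prod_mul_archStableOrbitalIntegral_kottwitzSign_eq_of_archStableOrbitalIntegral_regular_eq
    (z0 : {w : InfinitePlace L // IsComplex w} → Fin 3 → Circle) (hwall : ∀ v, z0 v 0 = z0 v 2 ∧ z0 v 0 ≠ z0 v 1)
    (z₁ : {w : InfinitePlace L // IsComplex w} → Fin 3 → Circle) (h02 : ∀ v, z₁ v 0 = z₁ v 2) (h01 : ∀ v, z₁ v 0 ≠ z₁ v 1)
    -- ===== side `α` =====
    (hα : ∀ i, α i ≠ 0) (hherm : ∀ i, (IsCMField.complexConj L (α i) : L) = α i)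
    (νw : ∀ v : {w : InfinitePlace L // IsComplex w}, Measure (archLocal L 3 (Matrix.diagonal α) v)) (hνw : ∀ v, (νw v).IsHaarMeasure ∧ (νw v).IsMulRightInvariant)
    [iRα : ∀ (v : {w : InfinitePlace L // IsComplex w}) (τ : Perm (Fin 3)), MeasurableSpace (archLocal L 3 (Matrix.diagonal (α ∘ ⇑τ)) v ⧸ Subgroup.centralizer
      ({(⟨circleDiagonal 3 (z₁ v), circleDiagonal_mem_archLocal_diagonal L 3 (α ∘ ⇑τ) v (z₁ v)⟩ : archLocal L 3 (Matrix.diagonal (α ∘ ⇑τ)) v)} :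
        Set (archLocal L 3 (Matrix.diagonal (α ∘ ⇑τ)) v)))]
    [iRαb : ∀ (v : {w : InfinitePlace L // IsComplex w}) (τ : Perm (Fin 3)), BorelSpace (archLocal L 3 (Matrix.diagonal (α ∘ ⇑τ)) v ⧸ Subgroup.centralizer
      ({(⟨circleDiagonal 3 (z₁ v), circleDiagonal_mem_archLocal_diagonal L 3 (α ∘ ⇑τ) v (z₁ v)⟩ : archLocal L 3 (Matrix.diagonal (α ∘ ⇑τ)) v)} :
        Set (archLocal L 3 (Matrix.diagonal (α ∘ ⇑τ)) v)))]
    (νH : ∀ (v : {w : InfinitePlace L // IsComplex w}) (τ : Perm (Fin 3)), Measure (Subgroup.centralizer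
      ({(⟨circleDiagonal 3 (z₁ v), circleDiagonal_mem_archLocal_diagonal L 3 (α ∘ ⇑τ) v (z₁ v)⟩ : archLocal L 3 (Matrix.diagonal (α ∘ ⇑τ)) v)} :
        Set (archLocal L 3 (Matrix.diagonal (α ∘ ⇑τ)) v))))
    (hνH : ∀ v τ, (νH v τ).IsHaarMeasure ∧ (νH v τ).IsInvInvariant)
    (ντ : ∀ (v : {w : InfinitePlace L // IsComplex w}) (τ : Perm (Fin 3)), Measure (archLocal L 3 (Matrix.diagonal (α ∘ ⇑τ)) v))
    (hντi : ∀ v τ, (ντ v τ).IsHaarMeasure ∧ (ντ v τ).IsMulRightInvariant)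
    (hντ : ντ = fun v τ => (νw v).map (ContinuousMulEquiv.restrictSubgroup (GLn.conjEquiv (Matrix.GeneralLinearGroup.mkOfDetNeZero _ (det_monomial_one_ne_zero 3 τ)))
              (archLocal L 3 (Matrix.diagonal (α ∘ ⇑τ)) v) (archLocal L 3 (Matrix.diagonal α) v)
              (mem_archLocal_comp_perm_iff_conj_mem L 3 α v τ)).symm)
    (Θ : Matrix (Fin 3) (Fin 3) (mixedSpace L) → ℂ) (hΘ : ContDiff ℝ (⊤ : ℕ∞) Θ)
    (hΘc : HasCompactSupport fun g : arch (↥(maximalRealSubfield L)) L (IsCMField.complexConj L) 3 (Matrix.diagonal α) => Θ ((g : GL (Fin 3) (mixedSpace L)) : Matrix (Fin 3) (Fin 3) (mixedSpace L)))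
    (c : {w : InfinitePlace L // IsComplex w} → Perm (Fin 3) → ℂ)
    (hcl : ∀ (v : {w : InfinitePlace L // IsComplex w}), ∀ (τ : Perm (Fin 3)), (v.1.embedding (α (τ 0))).re * (v.1.embedding (α (τ 2))).re < 0 →
      haveI : LocallyCompactSpace (archLocal L 3 (Matrix.diagonal (α ∘ ⇑τ)) v) := locallyCompactSpace_archLocal L 3 (Matrix.diagonal (α ∘ ⇑τ)) v
      haveI : SecondCountableTopology (archLocal L 3 (Matrix.diagonal (α ∘ ⇑τ)) v) := secondCountableTopology_archLocal L 3 (Matrix.diagonal (α ∘ ⇑τ)) v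
      haveI : (νH v τ).IsHaarMeasure := (hνH v τ).1
      haveI : (νH v τ).IsInvInvariant := (hνH v τ).2
      haveI : (ντ v τ).IsHaarMeasure := (hντi v τ).1
      haveI : (ντ v τ).IsMulRightInvariant := (hντi v τ).2
      ∀ (Θ : Matrix (Fin 3) (Fin 3) ℂ → ℂ), ContDiff ℝ (⊤ : ℕ∞) Θ →
        HasCompactSupport (fun k : archLocal L 3 (Matrix.diagonal (α ∘ ⇑τ)) v => Θ ((k : GL (Fin 3) ℂ) : Matrix (Fin 3) (Fin 3) ℂ)) →
        ∀ (z₀ : Fin 3 → Circle) (h02' : z₀ 0 = z₀ 2) (h01' : z₀ 0 ≠ z₀ 1),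
          Tendsto (fun ψ : ℝ => deriv (fun ψ : ℝ => (2 * Real.sin ψ : ℂ) *
              ∫ g, Θ (((g * ⟨circleDiagonal 3 (fun i => z₀ i * Circle.exp (![(1 : ℝ), 0, -1] i * ψ)),
                circleDiagonal_mem_archLocal_diagonal L 3 (α ∘ ⇑τ) v _⟩ * g⁻¹ : archLocal L 3 (Matrix.diagonal (α ∘ ⇑τ)) v) : GL (Fin 3) ℂ) : Matrix (Fin 3) (Fin 3) ℂ)
                ∂(ντ v τ)) ψ)
            (𝓝[≠] 0)
            (𝓝 (c v τ * ∫ y, descConj (⟨circleDiagonal 3 z₀, circleDiagonal_mem_archLocal_diagonal L 3 (α ∘ ⇑τ) v z₀⟩ : archLocal L 3 (Matrix.diagonal (α ∘ ⇑τ)) v)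
              (Subgroup.centralizer ({(⟨circleDiagonal 3 (z₁ v), circleDiagonal_mem_archLocal_diagonal L 3 (α ∘ ⇑τ) v (z₁ v)⟩ : archLocal L 3 (Matrix.diagonal (α ∘ ⇑τ)) v)} :
                Set (archLocal L 3 (Matrix.diagonal (α ∘ ⇑τ)) v)))
              (forall_mem_centralizer_circleDiagonal_comm_of_wall L (α ∘ ⇑τ) v (h02 v) (h01 v) h02' h01')
              (fun k : archLocal L 3 (Matrix.diagonal (α ∘ ⇑τ)) v => Θ ((k : GL (Fin 3) ℂ) : Matrix (Fin 3) (Fin 3) ℂ)) y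
              ∂(quotientMeasure _ (νH v τ) (isClosed_coe_centralizer_singleton _)
                (ντ v τ)))))
    -- centraliser measures on `G_v(α)` at the relabelled wall points, transported from the reference measures at the NONCOMPACT walls
    (ρZ : ∀ (v : {w : InfinitePlace L // IsComplex w}) (σ : Perm (Fin 3)), Measure (Subgroup.centralizer
      ({(⟨circleDiagonal 3 (z0 v ∘ ⇑σ), circleDiagonal_mem_archLocal_diagonal L 3 α v (z0 v ∘ ⇑σ)⟩ : archLocal L 3 (Matrix.diagonal α) v)} : Set (archLocal L 3 (Matrix.diagonal α) v))))
    (hρZi : ∀ v σ, (ρZ v σ).IsHaarMeasure ∧ (ρZ v σ).IsInvInvariant)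
    (hρZ : ∀ (v : {w : InfinitePlace L // IsComplex w}) (σ : Perm (Fin 3)), ¬ 0 < (v.1.embedding (α (σ⁻¹ 0))).re * (v.1.embedding (α (σ⁻¹ 2))).re →
      ρZ v σ = (νH v σ⁻¹).map (subgroupCongrHomeomorph (ContinuousMulEquiv.restrictSubgroup (GLn.conjEquiv (Matrix.GeneralLinearGroup.mkOfDetNeZero _ (det_monomial_one_ne_zero 3 σ⁻¹)))
        (archLocal L 3 (Matrix.diagonal (α ∘ ⇑σ⁻¹)) v) (archLocal L 3 (Matrix.diagonal α) v) (mem_archLocal_comp_perm_iff_conj_mem L 3 α v σ⁻¹)).toMulEquiv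
        (Subgroup.centralizer ({(⟨circleDiagonal 3 (z₁ v), circleDiagonal_mem_archLocal_diagonal L 3 (α ∘ ⇑σ⁻¹) v (z₁ v)⟩ : archLocal L 3 (Matrix.diagonal (α ∘ ⇑σ⁻¹)) v)} : Set (archLocal L 3 (Matrix.diagonal (α ∘ ⇑σ⁻¹)) v)))
        (Subgroup.centralizer ({(⟨circleDiagonal 3 (z0 v ∘ ⇑σ), circleDiagonal_mem_archLocal_diagonal L 3 α v (z0 v ∘ ⇑σ)⟩ : archLocal L 3 (Matrix.diagonal α) v)} : Set (archLocal L 3 (Matrix.diagonal α) v)))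
        (relabel_inv_mem_centralizer_circleDiagonal_comp_iff L α v σ (h02 v) (h01 v) (hwall v).1 (hwall v).2)
        (ContinuousMulEquiv.restrictSubgroup (GLn.conjEquiv (Matrix.GeneralLinearGroup.mkOfDetNeZero _ (det_monomial_one_ne_zero 3 σ⁻¹)))
          (archLocal L 3 (Matrix.diagonal (α ∘ ⇑σ⁻¹)) v) (archLocal L 3 (Matrix.diagonal α) v) (mem_archLocal_comp_perm_iff_conj_mem L 3 α v σ⁻¹)).continuous
        (ContinuousMulEquiv.restrictSubgroup (GLn.conjEquiv (Matrix.GeneralLinearGroup.mkOfDetNeZero _ (det_monomial_one_ne_zero 3 σ⁻¹)))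
          (archLocal L 3 (Matrix.diagonal (α ∘ ⇑σ⁻¹)) v) (archLocal L 3 (Matrix.diagonal α) v) (mem_archLocal_comp_perm_iff_conj_mem L 3 α v σ⁻¹)).symm.continuous))
    -- the wall constants (DATA) with their evaluation: one noncompact constant `−M_v` and one compact mass `M_v` per place
    (M : {w : InfinitePlace L // IsComplex w} → ℝ)
    (hC : ∀ (v : {w : InfinitePlace L // IsComplex w}) (σ : Perm (Fin 3)),
      ¬ 0 < (v.1.embedding (α (σ⁻¹ 0))).re * (v.1.embedding (α (σ⁻¹ 2))).re → c v σ⁻¹ = -(M v : ℂ))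
    (hM : ∀ (v : {w : InfinitePlace L // IsComplex w}) (σ : Perm (Fin 3)),
      0 < (v.1.embedding (α (σ⁻¹ 0))).re * (v.1.embedding (α (σ⁻¹ 2))).re → ((ρZ v σ) Set.univ).toReal = M v)
    -- ★ (R1-c)'s telescope at EVERY point `t(z⁰ ∘ ρ)`, and the Weil form of `m` there
    [iPα : ∀ ρ : {w : InfinitePlace L // IsComplex w} → Perm (Fin 3), MeasurableSpace ((∀ w : {w : InfinitePlace L // IsComplex w}, archLocal L 3 (Matrix.diagonal α) w) ⧸ Subgroup.pi Set.univ (fun w =>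
      Subgroup.centralizer ({(⟨circleDiagonal 3 (z0 w ∘ ⇑(ρ w)), circleDiagonal_mem_archLocal_diagonal L 3 α w (z0 w ∘ ⇑(ρ w))⟩ : archLocal L 3 (Matrix.diagonal α) w)} : Set _)))]
    [iPαb : ∀ ρ : {w : InfinitePlace L // IsComplex w} → Perm (Fin 3), BorelSpace ((∀ w : {w : InfinitePlace L // IsComplex w}, archLocal L 3 (Matrix.diagonal α) w) ⧸ Subgroup.pi Set.univ (fun w =>
      Subgroup.centralizer ({(⟨circleDiagonal 3 (z0 w ∘ ⇑(ρ w)), circleDiagonal_mem_archLocal_diagonal L 3 α w (z0 w ∘ ⇑(ρ w))⟩ : archLocal L 3 (Matrix.diagonal α) w)} : Set _)))]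
    (ρP : ∀ ρ : {w : InfinitePlace L // IsComplex w} → Perm (Fin 3), Measure (Subgroup.pi Set.univ (fun w : {w : InfinitePlace L // IsComplex w} => Subgroup.centralizer
      ({(⟨circleDiagonal 3 (z0 w ∘ ⇑(ρ w)), circleDiagonal_mem_archLocal_diagonal L 3 α w (z0 w ∘ ⇑(ρ w))⟩ : archLocal L 3 (Matrix.diagonal α) w)} : Set _))))
    (hρPi : ∀ ρ, (ρP ρ).IsHaarMeasure ∧ (ρP ρ).IsInvInvariant)
    (hρP : ∀ ρ : {w : InfinitePlace L // IsComplex w} → Perm (Fin 3), Measure.map (subgroupPiCoords fun w : {w : InfinitePlace L // IsComplex w} => Subgroup.centralizer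
      ({(⟨circleDiagonal 3 (z0 w ∘ ⇑(ρ w)), circleDiagonal_mem_archLocal_diagonal L 3 α w (z0 w ∘ ⇑(ρ w))⟩ : archLocal L 3 (Matrix.diagonal α) w)} : Set _)) (ρP ρ) =
        Measure.pi fun w => ρZ w (ρ w))
    [iHα : ((Measure.pi νw).map (archPiEquivCM 3 L (Matrix.diagonal α)).symm).IsHaarMeasure]
    [iHαr : ((Measure.pi νw).map (archPiEquivCM 3 L (Matrix.diagonal α)).symm).IsMulRightInvariant]
    (m : OrbitalMeasureFamily (arch (↥(maximalRealSubfield L)) L (IsCMField.complexConj L) 3 (Matrix.diagonal α)))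
    [iSα : ∀ q : ConjClasses (arch (↥(maximalRealSubfield L)) L (IsCMField.complexConj L) 3 (Matrix.diagonal α)),
      SMulInvariantMeasure (arch (↥(maximalRealSubfield L)) L (IsCMField.complexConj L) 3 (Matrix.diagonal α))
      (arch (↥(maximalRealSubfield L)) L (IsCMField.complexConj L) 3 (Matrix.diagonal α) ⧸
        Subgroup.centralizer ({(Quotient.out q : arch (↥(maximalRealSubfield L)) L (IsCMField.complexConj L) 3 (Matrix.diagonal α))} : Set _)) (m q)]
    (ρ' : ∀ ρ : {w : InfinitePlace L // IsComplex w} → Perm (Fin 3),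
      Measure (Subgroup.centralizer ({archDiagTorus L 3 α fun w => z0 w ∘ ⇑(ρ w)} : Set (arch (↥(maximalRealSubfield L)) L (IsCMField.complexConj L) 3 (Matrix.diagonal α)))))
    (hρ'i : ∀ ρ, (ρ' ρ).IsHaarMeasure ∧ (ρ' ρ).IsInvInvariant)
    (hρ' : ∀ ρ : {w : InfinitePlace L // IsComplex w} → Perm (Fin 3), ρ' ρ = (ρP ρ).map (subgroupCongrHomeomorph (archPiEquivCM 3 L (Matrix.diagonal α)).symm.toMulEquiv
      (Subgroup.pi Set.univ (fun w : {w : InfinitePlace L // IsComplex w} => Subgroup.centralizer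
        ({(⟨circleDiagonal 3 (z0 w ∘ ⇑(ρ w)), circleDiagonal_mem_archLocal_diagonal L 3 α w (z0 w ∘ ⇑(ρ w))⟩ : archLocal L 3 (Matrix.diagonal α) w)} : Set _)))
      (Subgroup.centralizer ({archDiagTorus L 3 α fun w => z0 w ∘ ⇑(ρ w)} : Set _))
      (apply_mem_centralizer_iff_mem_pi_centralizer _ (archPiEquivCM 3 L (Matrix.diagonal α)).symm.toMulEquiv
        (archPiEquivCM_symm_circleDiagonal_eq_archDiagTorus L 3 α fun w => z0 w ∘ ⇑(ρ w)))
      (archPiEquivCM 3 L (Matrix.diagonal α)).symm.continuous (archPiEquivCM 3 L (Matrix.diagonal α)).continuous))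
    (hq : ∀ ρ : {w : InfinitePlace L // IsComplex w} → Perm (Fin 3),
      haveI : ∀ w : {w : InfinitePlace L // IsComplex w}, LocallyCompactSpace (archLocal L 3 (Matrix.diagonal α) w) := fun w => locallyCompactSpace_archLocal L 3 (Matrix.diagonal α) w
      haveI : ∀ w : {w : InfinitePlace L // IsComplex w}, SecondCountableTopology (archLocal L 3 (Matrix.diagonal α) w) := fun w => secondCountableTopology_archLocal L 3 (Matrix.diagonal α) w
      haveI : (ρ' ρ).IsHaarMeasure := (hρ'i ρ).1
      haveI : (ρ' ρ).IsInvInvariant := (hρ'i ρ).2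
      m.atPoint (archDiagTorus L 3 α fun w => z0 w ∘ ⇑(ρ w)) =
        quotientMeasure (Subgroup.centralizer ({archDiagTorus L 3 α fun w => z0 w ∘ ⇑(ρ w)} : Set _)) (ρ' ρ) (isClosed_coe_centralizer_singleton _)
          ((Measure.pi νw).map (archPiEquivCM 3 L (Matrix.diagonal α)).symm))
    -- ===== side `β` =====
    (hβ : ∀ i, β i ≠ 0) (hherm' : ∀ i, (IsCMField.complexConj L (β i) : L) = β i)
    (νw' : ∀ v : {w : InfinitePlace L // IsComplex w}, Measure (archLocal L 3 (Matrix.diagonal β) v)) (hνw' : ∀ v, (νw' v).IsHaarMeasure ∧ (νw' v).IsMulRightInvariant)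
    [iRβ : ∀ (v : {w : InfinitePlace L // IsComplex w}) (τ : Perm (Fin 3)), MeasurableSpace (archLocal L 3 (Matrix.diagonal (β ∘ ⇑τ)) v ⧸ Subgroup.centralizer
      ({(⟨circleDiagonal 3 (z₁ v), circleDiagonal_mem_archLocal_diagonal L 3 (β ∘ ⇑τ) v (z₁ v)⟩ : archLocal L 3 (Matrix.diagonal (β ∘ ⇑τ)) v)} :
        Set (archLocal L 3 (Matrix.diagonal (β ∘ ⇑τ)) v)))]
    [iRβb : ∀ (v : {w : InfinitePlace L // IsComplex w}) (τ : Perm (Fin 3)), BorelSpace (archLocal L 3 (Matrix.diagonal (β ∘ ⇑τ)) v ⧸ Subgroup.centralizer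
      ({(⟨circleDiagonal 3 (z₁ v), circleDiagonal_mem_archLocal_diagonal L 3 (β ∘ ⇑τ) v (z₁ v)⟩ : archLocal L 3 (Matrix.diagonal (β ∘ ⇑τ)) v)} :
        Set (archLocal L 3 (Matrix.diagonal (β ∘ ⇑τ)) v)))]
    (νH' : ∀ (v : {w : InfinitePlace L // IsComplex w}) (τ : Perm (Fin 3)), Measure (Subgroup.centralizer
      ({(⟨circleDiagonal 3 (z₁ v), circleDiagonal_mem_archLocal_diagonal L 3 (β ∘ ⇑τ) v (z₁ v)⟩ : archLocal L 3 (Matrix.diagonal (β ∘ ⇑τ)) v)} :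
        Set (archLocal L 3 (Matrix.diagonal (β ∘ ⇑τ)) v))))
    (hνH' : ∀ v τ, (νH' v τ).IsHaarMeasure ∧ (νH' v τ).IsInvInvariant)
    (ντ' : ∀ (v : {w : InfinitePlace L // IsComplex w}) (τ : Perm (Fin 3)), Measure (archLocal L 3 (Matrix.diagonal (β ∘ ⇑τ)) v))
    (hντi' : ∀ v τ, (ντ' v τ).IsHaarMeasure ∧ (ντ' v τ).IsMulRightInvariant)
    (hντ' : ντ' = fun v τ => (νw' v).map (ContinuousMulEquiv.restrictSubgroup (GLn.conjEquiv (Matrix.GeneralLinearGroup.mkOfDetNeZero _ (det_monomial_one_ne_zero 3 τ)))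
              (archLocal L 3 (Matrix.diagonal (β ∘ ⇑τ)) v) (archLocal L 3 (Matrix.diagonal β) v)
              (mem_archLocal_comp_perm_iff_conj_mem L 3 β v τ)).symm)
    (Θ' : Matrix (Fin 3) (Fin 3) (mixedSpace L) → ℂ) (hΘ' : ContDiff ℝ (⊤ : ℕ∞) Θ')
    (hΘ'c : HasCompactSupport fun g : arch (↥(maximalRealSubfield L)) L (IsCMField.complexConj L) 3 (Matrix.diagonal β) => Θ' ((g : GL (Fin 3) (mixedSpace L)) : Matrix (Fin 3) (Fin 3) (mixedSpace L)))
    (c' : {w : InfinitePlace L // IsComplex w} → Perm (Fin 3) → ℂ)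
    (hcl' : ∀ (v : {w : InfinitePlace L // IsComplex w}), ∀ (τ : Perm (Fin 3)), (v.1.embedding (β (τ 0))).re * (v.1.embedding (β (τ 2))).re < 0 →
      haveI : LocallyCompactSpace (archLocal L 3 (Matrix.diagonal (β ∘ ⇑τ)) v) := locallyCompactSpace_archLocal L 3 (Matrix.diagonal (β ∘ ⇑τ)) v
      haveI : SecondCountableTopology (archLocal L 3 (Matrix.diagonal (β ∘ ⇑τ)) v) := secondCountableTopology_archLocal L 3 (Matrix.diagonal (β ∘ ⇑τ)) v
      haveI : (νH' v τ).IsHaarMeasure := (hνH' v τ).1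
      haveI : (νH' v τ).IsInvInvariant := (hνH' v τ).2
      haveI : (ντ' v τ).IsHaarMeasure := (hντi' v τ).1
      haveI : (ντ' v τ).IsMulRightInvariant := (hντi' v τ).2
      ∀ (Θ' : Matrix (Fin 3) (Fin 3) ℂ → ℂ), ContDiff ℝ (⊤ : ℕ∞) Θ' →
        HasCompactSupport (fun k : archLocal L 3 (Matrix.diagonal (β ∘ ⇑τ)) v => Θ' ((k : GL (Fin 3) ℂ) : Matrix (Fin 3) (Fin 3) ℂ)) →
        ∀ (z₀ : Fin 3 → Circle) (h02' : z₀ 0 = z₀ 2) (h01' : z₀ 0 ≠ z₀ 1),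
          Tendsto (fun ψ : ℝ => deriv (fun ψ : ℝ => (2 * Real.sin ψ : ℂ) *
              ∫ g, Θ' (((g * ⟨circleDiagonal 3 (fun i => z₀ i * Circle.exp (![(1 : ℝ), 0, -1] i * ψ)),
                circleDiagonal_mem_archLocal_diagonal L 3 (β ∘ ⇑τ) v _⟩ * g⁻¹ : archLocal L 3 (Matrix.diagonal (β ∘ ⇑τ)) v) : GL (Fin 3) ℂ) : Matrix (Fin 3) (Fin 3) ℂ)
                ∂(ντ' v τ)) ψ)
            (𝓝[≠] 0)
            (𝓝 (c' v τ * ∫ y, descConj (⟨circleDiagonal 3 z₀, circleDiagonal_mem_archLocal_diagonal L 3 (β ∘ ⇑τ) v z₀⟩ : archLocal L 3 (Matrix.diagonal (β ∘ ⇑τ)) v)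
              (Subgroup.centralizer ({(⟨circleDiagonal 3 (z₁ v), circleDiagonal_mem_archLocal_diagonal L 3 (β ∘ ⇑τ) v (z₁ v)⟩ : archLocal L 3 (Matrix.diagonal (β ∘ ⇑τ)) v)} :
                Set (archLocal L 3 (Matrix.diagonal (β ∘ ⇑τ)) v)))
              (forall_mem_centralizer_circleDiagonal_comm_of_wall L (β ∘ ⇑τ) v (h02 v) (h01 v) h02' h01')
              (fun k : archLocal L 3 (Matrix.diagonal (β ∘ ⇑τ)) v => Θ' ((k : GL (Fin 3) ℂ) : Matrix (Fin 3) (Fin 3) ℂ)) y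
              ∂(quotientMeasure _ (νH' v τ) (isClosed_coe_centralizer_singleton _)
                (ντ' v τ)))))
    -- centraliser measures on `G_v(α)` at the relabelled wall points, transported from the reference measures at the NONCOMPACT walls
    (ρZ' : ∀ (v : {w : InfinitePlace L // IsComplex w}) (σ : Perm (Fin 3)), Measure (Subgroup.centralizer
      ({(⟨circleDiagonal 3 (z0 v ∘ ⇑σ), circleDiagonal_mem_archLocal_diagonal L 3 β v (z0 v ∘ ⇑σ)⟩ : archLocal L 3 (Matrix.diagonal β) v)} : Set (archLocal L 3 (Matrix.diagonal β) v))))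
    (hρZ'i : ∀ v σ, (ρZ' v σ).IsHaarMeasure ∧ (ρZ' v σ).IsInvInvariant)
    (hρZ' : ∀ (v : {w : InfinitePlace L // IsComplex w}) (σ : Perm (Fin 3)), ¬ 0 < (v.1.embedding (β (σ⁻¹ 0))).re * (v.1.embedding (β (σ⁻¹ 2))).re →
      ρZ' v σ = (νH' v σ⁻¹).map (subgroupCongrHomeomorph (ContinuousMulEquiv.restrictSubgroup (GLn.conjEquiv (Matrix.GeneralLinearGroup.mkOfDetNeZero _ (det_monomial_one_ne_zero 3 σ⁻¹)))
        (archLocal L 3 (Matrix.diagonal (β ∘ ⇑σ⁻¹)) v) (archLocal L 3 (Matrix.diagonal β) v) (mem_archLocal_comp_perm_iff_conj_mem L 3 β v σ⁻¹)).toMulEquiv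
        (Subgroup.centralizer ({(⟨circleDiagonal 3 (z₁ v), circleDiagonal_mem_archLocal_diagonal L 3 (β ∘ ⇑σ⁻¹) v (z₁ v)⟩ : archLocal L 3 (Matrix.diagonal (β ∘ ⇑σ⁻¹)) v)} : Set (archLocal L 3 (Matrix.diagonal (β ∘ ⇑σ⁻¹)) v)))
        (Subgroup.centralizer ({(⟨circleDiagonal 3 (z0 v ∘ ⇑σ), circleDiagonal_mem_archLocal_diagonal L 3 β v (z0 v ∘ ⇑σ)⟩ : archLocal L 3 (Matrix.diagonal β) v)} : Set (archLocal L 3 (Matrix.diagonal β) v)))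
        (relabel_inv_mem_centralizer_circleDiagonal_comp_iff L β v σ (h02 v) (h01 v) (hwall v).1 (hwall v).2)
        (ContinuousMulEquiv.restrictSubgroup (GLn.conjEquiv (Matrix.GeneralLinearGroup.mkOfDetNeZero _ (det_monomial_one_ne_zero 3 σ⁻¹)))
          (archLocal L 3 (Matrix.diagonal (β ∘ ⇑σ⁻¹)) v) (archLocal L 3 (Matrix.diagonal β) v) (mem_archLocal_comp_perm_iff_conj_mem L 3 β v σ⁻¹)).continuous
        (ContinuousMulEquiv.restrictSubgroup (GLn.conjEquiv (Matrix.GeneralLinearGroup.mkOfDetNeZero _ (det_monomial_one_ne_zero 3 σ⁻¹)))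
          (archLocal L 3 (Matrix.diagonal (β ∘ ⇑σ⁻¹)) v) (archLocal L 3 (Matrix.diagonal β) v) (mem_archLocal_comp_perm_iff_conj_mem L 3 β v σ⁻¹)).symm.continuous))
    -- the wall constants (DATA) with their evaluation: one noncompact constant `−M_v` and one compact mass `M_v` per place
    (M' : {w : InfinitePlace L // IsComplex w} → ℝ)
    (hC' : ∀ (v : {w : InfinitePlace L // IsComplex w}) (σ : Perm (Fin 3)),
      ¬ 0 < (v.1.embedding (β (σ⁻¹ 0))).re * (v.1.embedding (β (σ⁻¹ 2))).re → c' v σ⁻¹ = -(M' v : ℂ))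
    (hM' : ∀ (v : {w : InfinitePlace L // IsComplex w}) (σ : Perm (Fin 3)),
      0 < (v.1.embedding (β (σ⁻¹ 0))).re * (v.1.embedding (β (σ⁻¹ 2))).re → ((ρZ' v σ) Set.univ).toReal = M' v)
    -- ★ (R1-c)'s telescope at EVERY point `t(z⁰ ∘ ρ)`, and the Weil form of `m` there
    [iPβ : ∀ ρ : {w : InfinitePlace L // IsComplex w} → Perm (Fin 3), MeasurableSpace ((∀ w : {w : InfinitePlace L // IsComplex w}, archLocal L 3 (Matrix.diagonal β) w) ⧸ Subgroup.pi Set.univ (fun w =>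
      Subgroup.centralizer ({(⟨circleDiagonal 3 (z0 w ∘ ⇑(ρ w)), circleDiagonal_mem_archLocal_diagonal L 3 β w (z0 w ∘ ⇑(ρ w))⟩ : archLocal L 3 (Matrix.diagonal β) w)} : Set _)))]
    [iPβb : ∀ ρ : {w : InfinitePlace L // IsComplex w} → Perm (Fin 3), BorelSpace ((∀ w : {w : InfinitePlace L // IsComplex w}, archLocal L 3 (Matrix.diagonal β) w) ⧸ Subgroup.pi Set.univ (fun w =>
      Subgroup.centralizer ({(⟨circleDiagonal 3 (z0 w ∘ ⇑(ρ w)), circleDiagonal_mem_archLocal_diagonal L 3 β w (z0 w ∘ ⇑(ρ w))⟩ : archLocal L 3 (Matrix.diagonal β) w)} : Set _)))]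
    (ρP' : ∀ ρ : {w : InfinitePlace L // IsComplex w} → Perm (Fin 3), Measure (Subgroup.pi Set.univ (fun w : {w : InfinitePlace L // IsComplex w} => Subgroup.centralizer
      ({(⟨circleDiagonal 3 (z0 w ∘ ⇑(ρ w)), circleDiagonal_mem_archLocal_diagonal L 3 β w (z0 w ∘ ⇑(ρ w))⟩ : archLocal L 3 (Matrix.diagonal β) w)} : Set _))))
    (hρP'i : ∀ ρ, (ρP' ρ).IsHaarMeasure ∧ (ρP' ρ).IsInvInvariant)
    (hρP' : ∀ ρ : {w : InfinitePlace L // IsComplex w} → Perm (Fin 3), Measure.map (subgroupPiCoords fun w : {w : InfinitePlace L // IsComplex w} => Subgroup.centralizer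
      ({(⟨circleDiagonal 3 (z0 w ∘ ⇑(ρ w)), circleDiagonal_mem_archLocal_diagonal L 3 β w (z0 w ∘ ⇑(ρ w))⟩ : archLocal L 3 (Matrix.diagonal β) w)} : Set _)) (ρP' ρ) =
        Measure.pi fun w => ρZ' w (ρ w))
    [iHβ : ((Measure.pi νw').map (archPiEquivCM 3 L (Matrix.diagonal β)).symm).IsHaarMeasure]
    [iHβr : ((Measure.pi νw').map (archPiEquivCM 3 L (Matrix.diagonal β)).symm).IsMulRightInvariant]
    (m' : OrbitalMeasureFamily (arch (↥(maximalRealSubfield L)) L (IsCMField.complexConj L) 3 (Matrix.diagonal β)))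
    [iSβ : ∀ q : ConjClasses (arch (↥(maximalRealSubfield L)) L (IsCMField.complexConj L) 3 (Matrix.diagonal β)),
      SMulInvariantMeasure (arch (↥(maximalRealSubfield L)) L (IsCMField.complexConj L) 3 (Matrix.diagonal β))
      (arch (↥(maximalRealSubfield L)) L (IsCMField.complexConj L) 3 (Matrix.diagonal β) ⧸
        Subgroup.centralizer ({(Quotient.out q : arch (↥(maximalRealSubfield L)) L (IsCMField.complexConj L) 3 (Matrix.diagonal β))} : Set _)) (m' q)]
    (ρ'' : ∀ ρ : {w : InfinitePlace L // IsComplex w} → Perm (Fin 3),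
      Measure (Subgroup.centralizer ({archDiagTorus L 3 β fun w => z0 w ∘ ⇑(ρ w)} : Set (arch (↥(maximalRealSubfield L)) L (IsCMField.complexConj L) 3 (Matrix.diagonal β)))))
    (hρ''i : ∀ ρ, (ρ'' ρ).IsHaarMeasure ∧ (ρ'' ρ).IsInvInvariant)
    (hρ'' : ∀ ρ : {w : InfinitePlace L // IsComplex w} → Perm (Fin 3), ρ'' ρ = (ρP' ρ).map (subgroupCongrHomeomorph (archPiEquivCM 3 L (Matrix.diagonal β)).symm.toMulEquiv
      (Subgroup.pi Set.univ (fun w : {w : InfinitePlace L // IsComplex w} => Subgroup.centralizer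
        ({(⟨circleDiagonal 3 (z0 w ∘ ⇑(ρ w)), circleDiagonal_mem_archLocal_diagonal L 3 β w (z0 w ∘ ⇑(ρ w))⟩ : archLocal L 3 (Matrix.diagonal β) w)} : Set _)))
      (Subgroup.centralizer ({archDiagTorus L 3 β fun w => z0 w ∘ ⇑(ρ w)} : Set _))
      (apply_mem_centralizer_iff_mem_pi_centralizer _ (archPiEquivCM 3 L (Matrix.diagonal β)).symm.toMulEquiv
        (archPiEquivCM_symm_circleDiagonal_eq_archDiagTorus L 3 β fun w => z0 w ∘ ⇑(ρ w)))
      (archPiEquivCM 3 L (Matrix.diagonal β)).symm.continuous (archPiEquivCM 3 L (Matrix.diagonal β)).continuous))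
    (hq' : ∀ ρ : {w : InfinitePlace L // IsComplex w} → Perm (Fin 3),
      haveI : ∀ w : {w : InfinitePlace L // IsComplex w}, LocallyCompactSpace (archLocal L 3 (Matrix.diagonal β) w) := fun w => locallyCompactSpace_archLocal L 3 (Matrix.diagonal β) w
      haveI : ∀ w : {w : InfinitePlace L // IsComplex w}, SecondCountableTopology (archLocal L 3 (Matrix.diagonal β) w) := fun w => secondCountableTopology_archLocal L 3 (Matrix.diagonal β) w
      haveI : (ρ'' ρ).IsHaarMeasure := (hρ''i ρ).1
      haveI : (ρ'' ρ).IsInvInvariant := (hρ''i ρ).2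
      m'.atPoint (archDiagTorus L 3 β fun w => z0 w ∘ ⇑(ρ w)) =
        quotientMeasure (Subgroup.centralizer ({archDiagTorus L 3 β fun w => z0 w ∘ ⇑(ρ w)} : Set _)) (ρ'' ρ) (isClosed_coe_centralizer_singleton _)
          ((Measure.pi νw').map (archPiEquivCM 3 L (Matrix.diagonal β)).symm))
    -- ===== the REGULAR identity, in stable-orbital-integral currency: canonical regular families for the product Haar measures on both carriers =====
    (νinf : Measure (arch (↥(maximalRealSubfield L)) L (IsCMField.complexConj L) 3 (Matrix.diagonal α))) (hνinfi : νinf.IsHaarMeasure ∧ νinf.IsMulRightInvariant)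
    (hνinf : νinf = (Measure.pi νw).map (archPiEquivCM 3 L (Matrix.diagonal α)).symm)
    (mreg : OrbitalMeasureFamily (arch (↥(maximalRealSubfield L)) L (IsCMField.complexConj L) 3 (Matrix.diagonal α)))
    (hmreg : haveI := hνinfi.1; haveI := hνinfi.2; mreg.IsCanonical (fun γ => IsRegularElt (γ.val : GL (Fin 3) (mixedSpace L))) νinf)
    (νinf' : Measure (arch (↥(maximalRealSubfield L)) L (IsCMField.complexConj L) 3 (Matrix.diagonal β))) (hνinfi' : νinf'.IsHaarMeasure ∧ νinf'.IsMulRightInvariant)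
    (hνinf' : νinf' = (Measure.pi νw').map (archPiEquivCM 3 L (Matrix.diagonal β)).symm)
    (mreg' : OrbitalMeasureFamily (arch (↥(maximalRealSubfield L)) L (IsCMField.complexConj L) 3 (Matrix.diagonal β)))
    (hmreg' : haveI := hνinfi'.1; haveI := hνinfi'.2; mreg'.IsCanonical (fun γ => IsRegularElt (γ.val : GL (Fin 3) (mixedSpace L))) νinf')
    (hregΦ : ∀ z : {w : InfinitePlace L // IsComplex w} → Fin 3 → Circle, (∀ v, Function.Injective (z v)) →
      archStableOrbitalIntegral L 3 (Matrix.diagonal α) mreg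
          (fun g : arch (↥(maximalRealSubfield L)) L (IsCMField.complexConj L) 3 (Matrix.diagonal α) => Θ ((g : GL (Fin 3) (mixedSpace L)) : Matrix (Fin 3) (Fin 3) (mixedSpace L))) (archDiagTorus L 3 α z) =
        archStableOrbitalIntegral L 3 (Matrix.diagonal β) mreg'
          (fun g : arch (↥(maximalRealSubfield L)) L (IsCMField.complexConj L) 3 (Matrix.diagonal β) => Θ' ((g : GL (Fin 3) (mixedSpace L)) : Matrix (Fin 3) (Fin 3) (mixedSpace L))) (archDiagTorus L 3 β z)) :
    (∏ v : {w : InfinitePlace L // IsComplex w}, (-(2 : ℂ) * M v)) *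
        archStableOrbitalIntegral L 3 (Matrix.diagonal α) m
          (fun x => kottwitzSignArchWeight L 3 (Matrix.diagonal α) (ConjClasses.mk x) *
            Θ ((x : GL (Fin 3) (mixedSpace L)) : Matrix (Fin 3) (Fin 3) (mixedSpace L))) (archDiagTorus L 3 α z0) =
      (∏ v : {w : InfinitePlace L // IsComplex w}, (-(2 : ℂ) * M' v)) *
        archStableOrbitalIntegral L 3 (Matrix.diagonal β) m'
          (fun x => kottwitzSignArchWeight L 3 (Matrix.diagonal β) (ConjClasses.mk x) *
            Θ' ((x : GL (Fin 3) (mixedSpace L)) : Matrix (Fin 3) (Fin 3) (mixedSpace L))) (archDiagTorus L 3 β z0) := by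
  have hreg : ∀ z : {w : InfinitePlace L // IsComplex w} → Fin 3 → Circle, (∀ v, Function.Injective (z v)) →
      ∑ ρ : {w : InfinitePlace L // IsComplex w} → Perm (Fin 3), ((∏ v : {w : InfinitePlace L // IsComplex w},
            (Finset.univ.filter fun i => 0 < (v.1.embedding (α i)).re).card.factorial *
              (3 - (Finset.univ.filter fun i => 0 < (v.1.embedding (α i)).re).card).factorial : ℕ) : ℂ)⁻¹ *
          ∫ o, Θ ((((archPiEquivCM 3 L (Matrix.diagonal α)).symm o : arch (↥(maximalRealSubfield L)) L (IsCMField.complexConj L) 3 (Matrix.diagonal α)) : GL (Fin 3) (mixedSpace L)) : Matrix (Fin 3) (Fin 3) (mixedSpace L))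
            ∂(Measure.pi fun v : {w : InfinitePlace L // IsComplex w} => (νw v).map fun y : archLocal L 3 (Matrix.diagonal α) v =>
              y * (⟨circleDiagonal 3 (z v ∘ ⇑(ρ v)), circleDiagonal_mem_archLocal_diagonal L 3 α v (z v ∘ ⇑(ρ v))⟩ : archLocal L 3 (Matrix.diagonal α) v) * y⁻¹) =
      ∑ ρ : {w : InfinitePlace L // IsComplex w} → Perm (Fin 3), ((∏ v : {w : InfinitePlace L // IsComplex w},
            (Finset.univ.filter fun i => 0 < (v.1.embedding (β i)).re).card.factorial *
              (3 - (Finset.univ.filter fun i => 0 < (v.1.embedding (β i)).re).card).factorial : ℕ) : ℂ)⁻¹ *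
          ∫ o, Θ' ((((archPiEquivCM 3 L (Matrix.diagonal β)).symm o : arch (↥(maximalRealSubfield L)) L (IsCMField.complexConj L) 3 (Matrix.diagonal β)) : GL (Fin 3) (mixedSpace L)) : Matrix (Fin 3) (Fin 3) (mixedSpace L))
            ∂(Measure.pi fun v : {w : InfinitePlace L // IsComplex w} => (νw' v).map fun y : archLocal L 3 (Matrix.diagonal β) v =>
              y * (⟨circleDiagonal 3 (z v ∘ ⇑(ρ v)), circleDiagonal_mem_archLocal_diagonal L 3 β v (z v ∘ ⇑(ρ v))⟩ : archLocal L 3 (Matrix.diagonal β) v) * y⁻¹) := by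
    intro z hz
    have h := hregΦ z hz
    haveI hn1 : ∀ v : {w : InfinitePlace L // IsComplex w}, (νw v).IsHaarMeasure := fun v => (hνw v).1
    haveI hi1 : νinf.IsHaarMeasure := hνinfi.1
    haveI hi2 : νinf.IsMulRightInvariant := hνinfi.2
    rw [archStableOrbitalIntegral_archDiagTorus_eq_inv_mul_sum_integral_pi_map_conj L 3 α hα hherm νw νinf hνinf hmreg hz Θ hΘ.continuous] at h
    clear hn1 hi1 hi2
    haveI hn2 : ∀ v : {w : InfinitePlace L // IsComplex w}, (νw' v).IsHaarMeasure := fun v => (hνw' v).1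
    haveI hi3 : νinf'.IsHaarMeasure := hνinfi'.1
    haveI hi4 : νinf'.IsMulRightInvariant := hνinfi'.2
    rw [archStableOrbitalIntegral_archDiagTorus_eq_inv_mul_sum_integral_pi_map_conj L 3 β hβ hherm' νw' νinf' hνinf' hmreg' hz Θ' hΘ'.continuous,
      Finset.mul_sum, Finset.mul_sum] at h
    exact h
  exact @prod_mul_archStableOrbitalIntegral_kottwitzSign_eq_of_regular_eq_of_clause L _ _ _ α β iGL iGLb iAα iAαb iAβ iAβb iQα iQαb iQβ iQβb iLα iLαb iLβ iLβb
    z0 hwall z₁ h02 h01 hα hherm νw hνw iRα iRαb νH hνH ντ hντi hντ Θ hΘ hΘc c hcl ρZ hρZi hρZ M hC hM iPα iPαb ρP hρPi hρP iHα iHαr m iSα ρ' hρ'i hρ' hq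
    hβ hherm' νw' hνw' iRβ iRβb νH' hνH' ντ' hντi' hντ' Θ' hΘ' hΘ'c c' hcl' ρZ' hρZ'i hρZ' M' hC' hM' iPβ iPβb ρP' hρP'i hρP' iHβ iHβr m' iSβ ρ'' hρ''i hρ'' hq' hreg

end Literature.NumberTheory.Rogawski1990

end
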